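import Summits.ABC.IUTFork.Joshi.LogLinkColumn

/-!
# [J-IIp] Rmk. 10.20.4 — Teichmüller lifts along the Frobenius column, over the period-ring signature (located, not adjudicated)

Block E, seat abc-iut-E-t7 (fallback claim J2p §10, approved E-plan-2 07:13:52Z), over E-t3's `PeriodRingDatum`
(`Joshi/ThetaValuesLocus.lean`, p427971) and `Joshi/LogLinkColumn.lean` (p429867: `column`, `scale_column_pt`,
`absK_emb_column_pt`) BY NAME. Source: K. Joshi, arXiv:2303.01662v3 (`paper:arxiv-2303.01662`, render
`HOME/lit/renders/Joshi-arxiv-2303.01662/pNNNN.txt`; bib `Joshi2023ATS2Local`; unrefereed — TYPED AS A CANDIDATE). TAKES NO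
SIDE on [IUTchIII] Cor. 3.12, on Joshi's claims, or on Mochizuki's reports on them; typed ≠ proved.

PRINT (Rmk. 10.20.4, p.36 l.18–43, the Tate-curve example): «Let `{y_n}` be as above … `K_n = K_{y_n} (≃ ℂ_p)` … `η_n` for
`η_{K_n} : W(O_{ℂ_p^♭}) → O_{K_n}`. Let `ξ ∈ O_{K_n}` with `|ξ|_{K_n} < 1`. Let `[z_n]` be a Teichmüller lift of `0 ≠ ξ ∈ 𝔪_{K_n}` …
For each `m ∈ ℤ`, let `ξ_m = η_m([z_n]) ∈ O_{K_m}`. Then for each `m`, `ξ_m ≠ 0`. This is immediately clear from [FF18,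
Lemma 2.2.13] and by Theorem 10.20.1 one has `|ξ_m|_{K_m} ≠ |ξ|_{K_n}`. Now let `[z_n]` resp. `[z_m]` be the lifts of the … Tate
parameter `q_m` of `X/K_m` resp. `q_n` of `X/K_n`. Then … one can consider the set `{η_n([z_m])}_{m∈ℤ} ⊂ K_n`. If `A ⊂ 𝔪 O_{K_n}` is
a compact, bounded subset of `K_n` then `{η_n([z_m])}_{m∈ℤ} ∩ A = {η_n([z_m]) : m ≫ −∞}`.»

WHAT THIS FILE RECORDS (kernel, over E-t3's signature; forward column `m ↦ ϕ^m(y_a)` as in `LogLinkColumn`).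
* `xiAt y z = η_y([z])`; `absK_xiAt`: `|η_y([z])|_{K_y} = |z|_F` for EVERY `y` (E-t3's field `absK_eta_teich` = [FF18 Prop. 2.2.17]
  as Joshi uses it in Prop. 7.4.2 (2)); hence `xiAt_ne_zero` («`ξ_m ≠ 0`», the [FF18 Lem. 2.2.13] clause) — DERIVED — and
  `absK_xiAt_eq` : `|ξ_m|_{K_m} = |ξ|_{K_n}` for all `m, n` — DERIVED EQUALITY.
* LOCATED (no verdict; for the faithfulness lane): the printed «by Theorem 10.20.1 one has `|ξ_m|_{K_m} ≠ |ξ|_{K_n}`» is typed as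
  the claim-`Prop` `XiAbsNe` and its NEGATION is a theorem over the signature (`not_xiAbsNe`): under the [FF18 2.2.17]
  normalisation `|η_y([a])|_{K_y} = |a|_F` (the one Thm. 10.20.1 (3) itself rests on: `absK_pt`), the Teichmüller readings do NOT
  move along the column; what moves is `|p|` (`absK_p_column_pt`) and `|ι(z)|` for `z ∈ Ē` (`absK_emb_column_pt`). The printed
  inequality is consistent only with a FIXED-`ℂ_p` normalisation of all `K_m` — the same reading fork (R-fix)/(R-ϕ) as for
  Thm. 10.15.1 (3) (`Joshi/LogLinkFrobeniusTransport.lean`). Located, not adjudicated.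
* The last display, forward half, for the Tate-parameter lifts: with `q ∈ Ē`, `0 < |q|_0 < 1`, the readings
  `r_m := |η_{y}([z_m])|_{K_y} = |q|_{K_{ϕ^m(y_a)}} = |q|_0^{p^m·s}` are STRICTLY DECREASING in `m` and tend below any `r > 0`
  (`tateLiftReading_succ_lt`, `exists_tateLiftReading_lt`), so for a ball `A = {|·| ≤ r}` the set `{m : η_n([z_m]) ∈ A}` is an
  upper set of `ℕ` — «`m ≫`» in the forward indexing (`mem_ball_upward`). (Print's two-sided `m ∈ ℤ` needs `ϕ^{-1}` on points,
  which the signature does not posit — E-t3's convention.)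
-/

noncomputable section

open Set

namespace Summit.ABC.IUTFork.Joshi

namespace PeriodRingDatum

variable {F B E0 : Type} [Field F] [CommRing B] [Field E0] {Y : Type} {K : Y → Type} [∀ y, Field (K y)] {G : Type}
  (D : PeriodRingDatum F B E0 Y K G)

/-! ## 1. `ξ_m = η_m([z])` and its size -/

/-- `ξ_m := η_{K_{y_m}}([z])` — the reading of the Teichmüller lift `[z]` at the point `y` (Rmk. 10.20.4, p.36 l.33–34).
[claim: Joshi2023ATS2Local, status: disputed] -/
def xiAt (y : Y) (z : F) : K y := D.eta y (D.teich z)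

/-- `|η_y([z])|_{K_y} = |z|_F` at EVERY point (E-t3's `absK_eta_teich` = [FF18 Prop. 2.2.17], as in Prop. 7.4.2 (2)). [folklore] -/
theorem absK_xiAt (y : Y) (z : F) : D.absK y (D.xiAt y z) = D.absF z := D.absK_eta_teich y z

/-- **«Then for each `m`, `ξ_m ≠ 0`»** (p.36 l.35–38, «immediately clear from [FF18, Lemma 2.2.13]»): DERIVED — a nonzero `z` has
`|η_y([z])|_{K_y} = |z|_F > 0`. [claim: Joshi2023ATS2Local, status: disputed] -/
theorem xiAt_ne_zero (y : Y) {z : F} (hz : z ≠ 0) : D.xiAt y z ≠ 0 := by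
  intro h
  have h1 : D.absK y (D.xiAt y z) = 0 := by rw [h, map_zero]
  rw [D.absK_xiAt] at h1
  exact hz ((map_eq_zero D.absF).1 h1)

/-- The Teichmüller readings do not move from point to point: `|η_{y₁}([z])|_{K_{y₁}} = |η_{y₂}([z])|_{K_{y₂}}` — in particular
`|ξ_m|_{K_m} = |ξ_n|_{K_n}` along the column. DERIVED EQUALITY over the signature. [folklore] -/
theorem absK_xiAt_eq (y₁ y₂ : Y) (z : F) : D.absK y₁ (D.xiAt y₁ z) = D.absK y₂ (D.xiAt y₂ z) := by
  rw [D.absK_xiAt, D.absK_xiAt]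

/-- **Rmk. 10.20.4, the printed inequality** (p.36 l.38–39): «by Theorem 10.20.1 one has `|ξ_m|_{K_m} ≠ |ξ|_{K_n}`», for
`ξ = η_n([z])` and `ξ_m = η_m([z])` at two points of the column (here: any two points). Joshi's CLAIM, typed; never asserted.
[claim: Joshi2023ATS2Local, status: disputed] -/
@[claim "Joshi2023ATS2Local" "disputed"]
def XiAbsNe (y₁ y₂ : Y) (z : F) : Prop := D.absK y₁ (D.xiAt y₁ z) ≠ D.absK y₂ (D.xiAt y₂ z)

/-- **LOCATED (no verdict):** over the signature the printed inequality FAILS for every pair of points and every `z` — the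
[FF18 2.2.17] normalisation `|η_y([a])|_{K_y} = |a|_F` (on which Thm. 10.20.1 (3) itself rests) makes the two readings equal.
What Thm. 10.20.1 moves along the column is `|p|` and `|ι(z)|`, `z ∈ Ē` (E-t3's `absK_p_column_pt`, `absK_emb_column_pt`), not
`|[z]|`. Consistent with print only under a fixed-`ℂ_p` normalisation of all `K_m` (reading (R-fix) of
`Joshi/LogLinkFrobeniusTransport.lean`). For the faithfulness lane. [claim: Joshi2023ATS2Local, status: disputed] -/
theorem not_xiAbsNe (y₁ y₂ : Y) (z : F) : ¬ D.XiAbsNe y₁ y₂ z := fun h => h (D.absK_xiAt_eq y₁ y₂ z)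

/-! ## 2. The last display (forward half): readings of the Tate-parameter lifts along the column -/

/-- The reading at the base point `y_a` of the Teichmüller lift `[z_m]` of (the image of) `q ∈ Ē` at the `m`-th point of the
column: `|η_{y_a}([z_m])|_{K_{y_a}} = |z_m|_F = |ι_{y_m}(q)|_{K_{y_m}}` — so we may read it directly as the latter
(`absK_xiAt` + the defining property of the lift). [claim: Joshi2023ATS2Local, status: disputed] -/
def tateLiftReading (a : F) (q : E0) (m : ℕ) : ℝ :=
  D.absK (D.column (D.pt a) m) (D.emb (D.column (D.pt a) m) q)

/-- The lift exists and its base-point reading IS `tateLiftReading`: for `|ι_{y_m}(q)| ≤ 1` there is `z_m` with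
`η_{y_m}([z_m]) = ι_{y_m}(q)`, and then `|η_{y}([z_m])|_{K_y} = tateLiftReading` at every `y`. DERIVED (`exists_teich_lift`,
`absK_eta_teich`). [claim: Joshi2023ATS2Local, status: disputed] -/
theorem exists_tateLift (a : F) (q : E0) (m : ℕ) (hq : D.absK _ (D.emb (D.column (D.pt a) m) q) ≤ 1) (y : Y) :
    ∃ z : F, D.eta (D.column (D.pt a) m) (D.teich z) = D.emb (D.column (D.pt a) m) q ∧
      D.absK y (D.xiAt y z) = D.tateLiftReading a q m := by
  obtain ⟨z, hz⟩ := D.exists_teich_lift _ _ hq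
  refine ⟨z, hz, ?_⟩
  rw [D.absK_xiAt, tateLiftReading, ← hz, D.absK_eta_teich]

/-- Closed form: `tateLiftReading a q m = |q|_0 ^ (p^m · scale(y_a))` (E-t3's `absK_emb_column_pt`, `absK_emb`). [folklore] -/
theorem tateLiftReading_eq {a : F} (ha0 : a ≠ 0) (ha : D.absF a < 1) (q : E0) (m : ℕ) :
    D.tateLiftReading a q m = (D.abs0 q ^ D.scale (D.pt a)) ^ D.p ^ m := by
  rw [tateLiftReading, D.absK_emb_column_pt ha0 ha m q, D.absK_emb]

/-- **«the valuations of the Tate parameters grow along the fiber»** in the example: for `0 < |q|_0 < 1` the readings are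
STRICTLY DECREASING in `m`. DERIVED. [claim: Joshi2023ATS2Local, status: disputed] -/
theorem tateLiftReading_succ_lt {a : F} (ha0 : a ≠ 0) (ha : D.absF a < 1) {q : E0} (hq0 : 0 < D.abs0 q)
    (hq1 : D.abs0 q < 1) (m : ℕ) : D.tateLiftReading a q (m + 1) < D.tateLiftReading a q m := by
  have hs := D.scale_pos (D.pt a)
  have hb0 : 0 < D.abs0 q ^ D.scale (D.pt a) := Real.rpow_pos_of_pos hq0 _
  have hb1 : D.abs0 q ^ D.scale (D.pt a) < 1 := Real.rpow_lt_one hq0.le hq1 hs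
  rw [D.tateLiftReading_eq ha0 ha, D.tateLiftReading_eq ha0 ha]
  exact pow_lt_pow_right_of_lt_one₀ hb0 hb1
    (Nat.pow_lt_pow_right D.p_prime.one_lt (Nat.lt_succ_self m))

/-- The readings are antitone in `m`. [folklore] -/
theorem tateLiftReading_antitone {a : F} (ha0 : a ≠ 0) (ha : D.absF a < 1) {q : E0} (hq0 : 0 < D.abs0 q)
    (hq1 : D.abs0 q < 1) : Antitone (D.tateLiftReading a q) :=
  antitone_nat_of_succ_le fun m => (D.tateLiftReading_succ_lt ha0 ha hq0 hq1 m).le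

/-- … and eventually smaller than any `r > 0` (`b^{p^m} ≤ b^m → 0` for `b ∈ (0,1)`). DERIVED. [folklore] -/
theorem exists_tateLiftReading_lt {a : F} (ha0 : a ≠ 0) (ha : D.absF a < 1) {q : E0} (hq0 : 0 < D.abs0 q)
    (hq1 : D.abs0 q < 1) {r : ℝ} (hr : 0 < r) : ∃ m : ℕ, D.tateLiftReading a q m < r := by
  set b := D.abs0 q ^ D.scale (D.pt a) with hb
  have hb0 : 0 < b := Real.rpow_pos_of_pos hq0 _
  have hb1 : b < 1 := Real.rpow_lt_one hq0.le hq1 (D.scale_pos (D.pt a))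
  obtain ⟨m, hm⟩ := exists_pow_lt_of_lt_one hr hb1
  refine ⟨m, ?_⟩
  rw [D.tateLiftReading_eq ha0 ha, ← hb]
  calc b ^ D.p ^ m ≤ b ^ m := pow_le_pow_of_le_one hb0.le hb1.le (Nat.lt_pow_self D.p_prime.one_lt).le
    _ < r := hm

/-- **The last display, forward half** (p.36 l.41–43): for a ball `A = {ξ : |ξ|_{K_n} ≤ r}`, `r > 0`, the indices `m` whose
Tate-lift reading lies in `A` form a NONEMPTY UPPER SET of `ℕ` («`{η_n([z_m])} ∩ A = {η_n([z_m]) : m ≫ …}`»). DERIVED.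
[claim: Joshi2023ATS2Local, status: disputed] -/
theorem mem_ball_upward {a : F} (ha0 : a ≠ 0) (ha : D.absF a < 1) {q : E0} (hq0 : 0 < D.abs0 q) (hq1 : D.abs0 q < 1)
    {r : ℝ} (hr : 0 < r) :
    (∃ m₀ : ℕ, D.tateLiftReading a q m₀ ≤ r) ∧
      ∀ m m' : ℕ, m ≤ m' → D.tateLiftReading a q m ≤ r → D.tateLiftReading a q m' ≤ r := by
  refine ⟨?_, fun m m' hmm' hm => (D.tateLiftReading_antitone ha0 ha hq0 hq1 hmm').trans hm⟩
  obtain ⟨m, hm⟩ := D.exists_tateLiftReading_lt ha0 ha hq0 hq1 hr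
  exact ⟨m, hm.le⟩

end PeriodRingDatum

end Summit.ABC.IUTFork.Joshi

end
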